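import Summits.HubbardSuperconductivity.HubbardSuperconductivity.Theorems.AnisotropyChordTransferFibre3TargetsV2

/-!
# Route `AnisotropyChord` / H0 rotor rung: PORT N30-A revised targets — `PoleComplementGap` PROVED

(MI) ingredient §284(b)(iii) of memo ROTOR-THEORY-20 (theory seat `hubbard-h0-rotor-theory-1`, cycle 20): orthogonally to
the three pole plane waves of the `K₁` fibre the free Hamiltonian is `≥ 3ε₁`:
**`poleComplementGap_holds : PoleComplementGap L`** — Parseval in the plane-wave basis (`fourier_inversion`,
`ip_pw_H0apply`) and the free gap `efree_ge` (from `FreeGap.freeGapK1_holds`, `L ≥ 4`); the pole coefficients vanish by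
hypothesis (`poleWave j` are the pole plane waves `pw 0 0`, `pw K₁ 0`, `pw 0 K₁`).
Prover seat `hubbard-h0-rotor-p1` g21; helper for stmt-HubbardSuperconductivity-19089 (`--supports`).
-/

set_option linter.dupNamespace false
set_option autoImplicit false

noncomputable section

open scoped BigOperators
open Complex

namespace Summit.HubbardSuperconductivity.HubbardSuperconductivity.Theorems.AnisotropyChord.Transfer.Fibre3

variable (L : ℕ) [NeZero L]

/-- Fourier coefficient `Ŷ_k = ⟨pw_k, Y⟩`. [folklore] -/
def fcoef (Y : Cfg L → ℂ) (k : Tor L × Tor L) : ℂ := ip L (pw L k.1 k.2) Y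

/-- `⟨Y, pw_k⟩ = conj Ŷ_k`. [folklore] -/
theorem ip_Y_pw (Y : Cfg L → ℂ) (k : Tor L × Tor L) : ip L Y (pw L k.1 k.2) = (starRingEnd ℂ) (fcoef L Y k) := by
  unfold fcoef; rw [conj_ip]

/-- **Parseval:** `⟨Y, Y⟩ = V⁻² Σ_k |Ŷ_k|²` (as `conj Ŷ_k · Ŷ_k`). [folklore] -/
theorem ip_self_fourier (Y : Cfg L → ℂ) :
    ip L Y Y = (1 / ((L : ℂ) ^ 2) ^ 2) * ∑ k : Tor L × Tor L, (starRingEnd ℂ) (fcoef L Y k) * fcoef L Y k := by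
  have hY : Y = fun c => (1 / ((L : ℂ) ^ 2) ^ 2) * ∑ k : Tor L × Tor L, fcoef L Y k * pw L k.1 k.2 c := by
    funext c; unfold fcoef; rw [fourier_inversion]
  conv_lhs => rw [show ip L Y Y = ip L Y (fun c => (1 / ((L : ℂ) ^ 2) ^ 2) * ∑ k : Tor L × Tor L,
    fcoef L Y k * pw L k.1 k.2 c) from by rw [← hY]]
  unfold ip
  simp_rw [Finset.mul_sum]
  rw [Finset.sum_comm]
  refine Finset.sum_congr rfl fun k _ => ?_
  have : ∑ c : Cfg L, (starRingEnd ℂ) (Y c) * ((1 / ((L : ℂ) ^ 2) ^ 2) * (fcoef L Y k * pw L k.1 k.2 c))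
      = (1 / ((L : ℂ) ^ 2) ^ 2) * fcoef L Y k * ∑ c : Cfg L, (starRingEnd ℂ) (Y c) * pw L k.1 k.2 c := by
    rw [Finset.mul_sum]; refine Finset.sum_congr rfl fun c _ => ?_; ring
  rw [this]
  have h2 : ∑ c : Cfg L, (starRingEnd ℂ) (Y c) * pw L k.1 k.2 c = (starRingEnd ℂ) (fcoef L Y k) := by
    rw [← ip_Y_pw]; rfl
  rw [h2]; ring

/-- **Parseval for `H₀`:** `⟨Y, H₀Y⟩ = V⁻² Σ_k e_k |Ŷ_k|²`. [folklore] -/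
theorem ip_H0_fourier (Y : Cfg L → ℂ) :
    ip L Y (H0apply L (K1 L) Y)
      = (1 / ((L : ℂ) ^ 2) ^ 2) * ∑ k : Tor L × Tor L, (efree L k : ℂ) * ((starRingEnd ℂ) (fcoef L Y k) * fcoef L Y k) := by
  have hY : Y = fun c => ∑ k : Tor L × Tor L, ((1 / ((L : ℂ) ^ 2) ^ 2) * fcoef L Y k) * pw L k.1 k.2 c := by
    funext c; unfold fcoef; rw [← fourier_inversion L Y c, Finset.mul_sum]
    refine Finset.sum_congr rfl fun k _ => ?_; ring
  have hH : ∀ c, H0apply L (K1 L) Y c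
      = ∑ k : Tor L × Tor L, ((1 / ((L : ℂ) ^ 2) ^ 2) * fcoef L Y k) * ((efree L k : ℂ) * pw L k.1 k.2 c) := by
    intro c
    conv_lhs => rw [hY]
    rw [H0apply_sum_smul]
    refine Finset.sum_congr rfl fun k _ => ?_
    rw [H0apply_pw]; rfl
  unfold ip
  simp_rw [hH, Finset.mul_sum]
  rw [Finset.sum_comm]
  refine Finset.sum_congr rfl fun k _ => ?_
  have : ∑ c : Cfg L, (starRingEnd ℂ) (Y c) * ((1 / ((L : ℂ) ^ 2) ^ 2) * fcoef L Y k * ((efree L k : ℂ) * pw L k.1 k.2 c))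
      = (1 / ((L : ℂ) ^ 2) ^ 2) * fcoef L Y k * (efree L k : ℂ) * ∑ c : Cfg L, (starRingEnd ℂ) (Y c) * pw L k.1 k.2 c := by
    rw [Finset.mul_sum]; refine Finset.sum_congr rfl fun c _ => ?_; ring
  rw [this]
  have h2 : ∑ c : Cfg L, (starRingEnd ℂ) (Y c) * pw L k.1 k.2 c = (starRingEnd ℂ) (fcoef L Y k) := by
    rw [← ip_Y_pw]; rfl
  rw [h2]; ring

/-- the pole waves are the pole plane waves. [folklore] -/
theorem poleWave_eq (c : Cfg L) :
    poleWave L 0 c = pw L 0 0 c ∧ poleWave L 1 c = pw L (K1 L) 0 c ∧ poleWave L 2 c = pw L 0 (K1 L) c := by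
  refine ⟨?_, ?_, ?_⟩
  · rw [pw_pole₀]; rfl
  · rw [pw_pole₁]; rfl
  · rw [pw_pole₂]; rfl

/-- orthogonality to the pole waves kills the pole Fourier coefficients. [folklore] -/
theorem fcoef_pole_eq_zero {Y : Cfg L → ℂ} (hY : ∀ j : Fin 3, ip L (poleWave L j) Y = 0)
    {k : Tor L × Tor L} (hk : IsPoleK1 L k.1 k.2 = true) : fcoef L Y k = 0 := by
  have h0 : poleWave L 0 = pw L 0 0 := funext fun c => (poleWave_eq L c).1
  have h1 : poleWave L 1 = pw L (K1 L) 0 := funext fun c => (poleWave_eq L c).2.1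
  have h2 : poleWave L 2 = pw L 0 (K1 L) := funext fun c => (poleWave_eq L c).2.2
  rcases (isPoleK1_iff L k).1 hk with hk0 | hk1 | hk2
  · rw [hk0]; unfold fcoef; have := hY 0; rw [h0] at this; exact this
  · rw [hk1]; unfold fcoef; have := hY 1; rw [h1] at this; exact this
  · rw [hk2]; unfold fcoef; have := hY 2; rw [h2] at this; exact this

/-- **`PoleComplementGap` holds:** orthogonally to the three pole waves, `Re⟨Y, H₀Y⟩ ≥ 3ε₁·Re⟨Y, Y⟩` (`L ≥ 4`).
[folklore] -/
theorem poleComplementGap_holds : PoleComplementGap L := by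
  intro hL Y hY
  rw [ip_self_fourier, ip_H0_fourier]
  have hV : (0 : ℝ) ≤ (1 / ((L : ℝ) ^ 2) ^ 2) := by positivity
  -- real parts termwise
  have hre1 : ((1 / ((L : ℂ) ^ 2) ^ 2) * ∑ k : Tor L × Tor L, (starRingEnd ℂ) (fcoef L Y k) * fcoef L Y k).re
      = (1 / ((L : ℝ) ^ 2) ^ 2) * ∑ k : Tor L × Tor L, ‖fcoef L Y k‖ ^ 2 := by
    have e : (1 / ((L : ℂ) ^ 2) ^ 2) = (((1 / ((L : ℝ) ^ 2) ^ 2 : ℝ)) : ℂ) := by push_cast; ring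
    rw [e, Complex.re_ofReal_mul, Complex.re_sum]
    congr 1
    refine Finset.sum_congr rfl fun k _ => ?_
    rw [Complex.conj_mul']; norm_cast
  have hre2 : ((1 / ((L : ℂ) ^ 2) ^ 2) * ∑ k : Tor L × Tor L,
        (efree L k : ℂ) * ((starRingEnd ℂ) (fcoef L Y k) * fcoef L Y k)).re
      = (1 / ((L : ℝ) ^ 2) ^ 2) * ∑ k : Tor L × Tor L, efree L k * ‖fcoef L Y k‖ ^ 2 := by
    have e : (1 / ((L : ℂ) ^ 2) ^ 2) = (((1 / ((L : ℝ) ^ 2) ^ 2 : ℝ)) : ℂ) := by push_cast; ring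
    rw [e, Complex.re_ofReal_mul, Complex.re_sum]
    congr 1
    refine Finset.sum_congr rfl fun k _ => ?_
    rw [Complex.conj_mul']
    norm_cast
  rw [hre1, hre2, ← mul_assoc, mul_comm (3 * eps1 L), mul_assoc]
  apply mul_le_mul_of_nonneg_left _ hV
  rw [Finset.mul_sum]
  apply Finset.sum_le_sum
  intro k _
  by_cases hk : IsPoleK1 L k.1 k.2 = true
  · rw [fcoef_pole_eq_zero L hY hk]; simp
  · have hk' : IsPoleK1 L k.1 k.2 = false := by simpa using hk
    have hge := efree_ge L hL hk'
    exact mul_le_mul_of_nonneg_right hge (sq_nonneg _)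

end Summit.HubbardSuperconductivity.HubbardSuperconductivity.Theorems.AnisotropyChord.Transfer.Fibre3

end
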